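import Literature.AlgebraicGeometry.HodgeTheory.AbelianVarietyEndomorphismsHOne
import Literature.AlgebraicTopology.SingularHomology.CupProductExteriorH1
import Literature.AlgebraicTopology.SingularHomology.CompactGroupExteriorCohomology
import Literature.AlgebraicTopology.SingularHomology.BettiNumberBaseChange
import Literature.AlgebraicTopology.SingularHomology.UniversalCoefficientsField
import Literature.AlgebraicGeometry.Motives.AbelianVarietyFundamentalGroup
import Literature.AlgebraicGeometry.Motives.AbelianVarietyTorsionPointsCountProofs
import Literature.AlgebraicGeometry.Motives.AbelianVarietyProjectiveChart
import HarnessLib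

/-!
# One test endomorphism versus all of them: eigenspaces of `(x₀·𝟙 + y₀·φ)^*` and the Weil lines

Layer `Literature/AlgebraicGeometry/HodgeTheory`, companion of `WeilClasses` (the Weil lines
`E± = weilClassesPlus/Minus A φ n d ⊆ H²ⁿ(A(ℂ); ℂ)`, cut out by ALL the test endomorphisms
`(x·𝟙 + y·φ)^*`, `x y : ℕ`, with the characters `(x ± y i√d)²ⁿ`) and of
`AbelianVarietyEndomorphismsHOne` (the wedge eigenbasis of `Hᵏ(A(ℂ); ℂ) = ⋀ᵏ H¹` diagonalising every
`(x·𝟙 + y·φ)^*` with character `∏_{i ∈ S} (x + y λᵢ)`, `λᵢ ∈ {± i√d}`; van Geemen, LNM 1594, proof of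
Thm. 6.12 and of Lemma 5.2 (6)). Several statements of the tree (route `HeckePrymWeil` of the Hodge
summit; the Literature fact `Motives.exists_cmWeilSurface_aimedSplitProduct_of_ne_one_of_ne_three`)
render "Weil type" with ONE test endomorphism, as an eigenspace of `(𝟙 + φ)^*`; the module
docstring of `Motives/AimedSplitProduct` (`## Misstatement`) explains that this agrees with the Weil
lines exactly when the single character `(1 + i√d)ᵃ (1 - i√d)ᵇ` has no collision, which fails only
for `d ∈ {1, 3}` in high degree and NEVER for surfaces. This file proves the comparison:

* `mem_pullbackEigenclasses_of_map_test_eq_smul` — the ENGINE, for any degree `k` and any test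
  value `(x₀, y₀)`: if `(x₀·𝟙 + y₀·φ)^* c = c₀ • c` and every sign pattern `ε : Fin k → {± i√d}` with
  `∏ᵢ (x₀ + y₀ εᵢ) = c₀` has `∏ᵢ (x + y εᵢ) = χ(x, y)` for all `x, y`, then `c` is a joint eigenclass
  of character `χ` (`c ∈ pullbackEigenclasses A φ k χ`) — expand `c` in the wedge eigenbasis; the
  surviving coordinates sit at sign patterns matched by the test value;
* `eigenspace_le_weilClassesPlus_two`, `eigenspace_le_weilClassesMinus_two` — **on an abelian
  SURFACE `B` with `ψ ≫ ψ = -(d • 𝟙 B)`, `d ≥ 1`, the eigenspaces of `(𝟙 + ψ)^*` on `H²(B(ℂ); ℂ)` for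
  `(1 ± i√d)²` are contained in the Weil lines `weilClassesPlus/Minus B ψ 1 d`** (the three
  characters `(1 + i√d)²`, `1 + d`, `(1 - i√d)²` of `⋀²H¹ = ⋀²V₊ ⊕ V₊∧V₋ ⊕ ⋀²V₋` are pairwise
  distinct).

Everything is proved (the exterior-algebra structure of `H•(B(ℂ); ℂ)` and `b₁ = 2 dim` are
assembled here, as in `Motives/AbelianVarietyCohomologyExteriorH1`, from the tree's theorems
`hasExteriorCohomologyH1_of_group`, `finrank_bettiCohomology_one_eq_of_natCard_torsionPoints`,
`natCard_torsionPoints_of_isAlgClosed_holds` — `surface_finrank_complexBetti_one`,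
`surface_hasExteriorCohomologyH1`); no definition and no named fact is introduced.

## References

* [vanGeemen1994HodgeAV] B. van Geemen, An introduction to the Hodge conjecture for abelian
  varieties, LNM 1594 (1994), 4.9, proof of Lemma 5.2 (6), proof of Thm. 6.12.
* [LangeBirkenhake1992] H. Lange, Ch. Birkenhake, Complex Abelian Varieties (1992), Lemma 1.1.17,
  Prop. 1.1.9.
-/

noncomputable section

open CategoryTheory

namespace Literature.AlgebraicGeometry.HodgeTheory

open Literature.AlgebraicTopology.SingularHomology
open Literature.AlgebraicGeometry.Motives

section Engine

variable {A : Motives.AbelianVariety ℂ}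

/-- **One test endomorphism versus all of them (engine).** Let `H•(A(ℂ); ℂ) = ⋀• H¹` with
`b₁ = 4m`, `φ ≫ φ = -(d • 𝟙 A)`, `d ≥ 1`, `μ = i√d`. Suppose `c ∈ Hᵏ(A(ℂ); ℂ)` satisfies
`(x₀·𝟙 + y₀·φ)^* c = c₀ • c` for ONE pair `(x₀, y₀)`, and that every sign pattern
`ε : Fin k → {μ, -μ}` whose character matches at the test value, `∏ᵢ (x₀ + y₀ εᵢ) = c₀`, has
`∏ᵢ (x + y εᵢ) = χ(x, y)` for all `x y : ℕ`. Then `c` is a joint eigenclass of ALL the test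
endomorphisms with character `χ`: `c ∈ pullbackEigenclasses A φ k χ`. Proof: in the wedge eigenbasis
`b_S = ⌣_{i ∈ S} bᵢ` of `Hᵏ` built on an eigenbasis of `H¹ = V_μ ⊕ V_{-μ}` (van Geemen, proof of
Thm. 6.12), `(x·𝟙 + y·φ)^* b_S = ∏_{i ∈ S} (x + y λᵢ) · b_S`; the coordinates of `c` vanish at every
`S` whose character differs from `c₀` at `(x₀, y₀)`, and at the others the character is `χ`.
[cite: vanGeemen1994HodgeAV, proof of Thm. 6.12 and of Lemma 5.2 (6)] -/
theorem mem_pullbackEigenclasses_of_map_test_eq_smul {m d k : ℕ}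
    (hΛ : HasExteriorCohomologyH1 ℂ (Motives.ComplexPoints A.X))
    (hb₁ : Module.finrank ℂ (complexBetti A.X 1) = 2 * (2 * m)) (hd : 0 < d) {φ : A ⟶ A}
    (hφ : φ ≫ φ = -(d • 𝟙 A)) (x₀ y₀ : ℕ) (c₀ : ℂ) (χ : ℕ → ℕ → ℂ)
    (H : ∀ ε : Fin k → ℂ,
      (∀ i, ε i = Complex.I * (Real.sqrt d : ℂ) ∨ ε i = -(Complex.I * (Real.sqrt d : ℂ))) →
      (∏ i, ((x₀ : ℂ) + (y₀ : ℂ) * ε i)) = c₀ →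
        ∀ x y : ℕ, (∏ i, ((x : ℂ) + (y : ℂ) * ε i)) = χ x y)
    {c : complexBetti A.X k}
    (hc : complexBetti.map (x₀ • 𝟙 A + y₀ • φ).hom.hom.hom k c = c₀ • c) :
    c ∈ pullbackEigenclasses A φ k χ := by
  classical
  haveI := finite_complexBetti_abelianVariety A 1
  set μ : ℂ := Complex.I * (Real.sqrt d : ℂ) with hμdef
  set T := (complexBetti.map φ.hom.hom.hom 1).hom with hT
  -- `H¹ = V_μ ⊕ V_{-μ}`, both of dimension `2m`
  have hps : Module.finrank ℂ (Module.End.eigenspace T μ) = 2 * m := by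
    have h := two_mul_finrank_eigenspace_eq hd hφ
    rw [hb₁] at h
    change 2 * Module.finrank ℂ (Module.End.eigenspace T μ) = 2 * (2 * m) at h
    omega
  have hqs : Module.finrank ℂ (Module.End.eigenspace T (-μ)) = 2 * m := by
    have h := finrank_eigenspace_eq_finrank_eigenspace_neg hd hφ
    change Module.finrank ℂ (Module.End.eigenspace T μ) =
      Module.finrank ℂ (Module.End.eigenspace T (-μ)) at h
    rw [← h, hps]
  have hcompl : IsCompl (Module.End.eigenspace T μ) (Module.End.eigenspace T (-μ)) :=
    isCompl_eigenspace_eigenspace_neg hd hφ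
  -- an eigenbasis of `H¹`, the `μ`-vectors first
  let bp := Module.finBasisOfFinrankEq ℂ (Module.End.eigenspace T μ) hps
  let bm := Module.finBasisOfFinrankEq ℂ (Module.End.eigenspace T (-μ)) hqs
  let b₀ : Module.Basis (Fin (2 * m) ⊕ Fin (2 * m)) ℂ (complexBetti A.X 1) :=
    (bp.prod bm).map (Submodule.prodEquivOfIsCompl _ _ hcompl)
  let b : Module.Basis (Fin (2 * m + 2 * m)) ℂ (complexBetti A.X 1) := b₀.reindex finSumFinEquiv
  let lam : Fin (2 * m + 2 * m) → ℂ := fun i =>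
    Sum.elim (fun _ => μ) (fun _ => -μ) (finSumFinEquiv.symm i)
  have hlam : ∀ i, lam i = μ ∨ lam i = -μ := fun i => by
    change Sum.elim (fun _ => μ) (fun _ => -μ) (finSumFinEquiv.symm i) = μ ∨
      Sum.elim (fun _ => μ) (fun _ => -μ) (finSumFinEquiv.symm i) = -μ
    rcases finSumFinEquiv.symm i with j | j
    · exact Or.inl rfl
    · exact Or.inr rfl
  have hb_mem : ∀ i, b i ∈ Module.End.eigenspace T (lam i) := by
    intro i
    rw [Module.Basis.reindex_apply]
    change b₀ (finSumFinEquiv.symm i) ∈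
      Module.End.eigenspace T (Sum.elim (fun _ => μ) (fun _ => -μ) (finSumFinEquiv.symm i))
    rcases finSumFinEquiv.symm i with j | j
    · simp only [Sum.elim_inl, b₀, Module.Basis.map_apply, Module.Basis.prod_apply, Function.comp_apply,
        LinearMap.inl_apply, Submodule.coe_prodEquivOfIsCompl', Submodule.coe_zero, add_zero]
      exact (bp j).2
    · simp only [Sum.elim_inr, b₀, Module.Basis.map_apply, Module.Basis.prod_apply, Function.comp_apply,
        LinearMap.inr_apply, Submodule.coe_prodEquivOfIsCompl', Submodule.coe_zero, zero_add]
      exact (bm j).2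
  -- the wedge basis of `Hᵏ` and the action of the test endomorphisms on it
  let Bw : Module.Basis (Set.powersetCard (Fin (2 * m + 2 * m)) k) ℂ (complexBetti A.X k) :=
    (b.exteriorPower k).map (hΛ.equiv k)
  have hBw : ∀ S, Bw S = cupPowOne ℂ (Motives.ComplexPoints A.X) k
      (b ∘ (Set.powersetCard.ofFinEmbEquiv.symm S)) := by
    intro S
    change hΛ.equiv k ((b.exteriorPower k) S) = _
    rw [exteriorPower.basis_apply, HasExteriorCohomologyH1.equiv_apply, exteriorPower.ιMulti_family,
      wedgeToCup_ιMulti]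
  -- the characters of the wedge basis vectors
  let cS : Set.powersetCard (Fin (2 * m + 2 * m)) k → ℕ × ℕ → ℂ := fun S p =>
    ∏ i : Fin k, ((p.1 : ℂ) + (p.2 : ℂ) * lam (Set.powersetCard.ofFinEmbEquiv.symm S i))
  let Tp : ℕ × ℕ → complexBetti A.X k →ₗ[ℂ] complexBetti A.X k := fun p =>
    (complexBetti.map (p.1 • 𝟙 A + p.2 • φ).hom.hom.hom k).hom
  have hact : ∀ (p : ℕ × ℕ) (S : Set.powersetCard (Fin (2 * m + 2 * m)) k),
      Tp p (Bw S) = cS S p • Bw S := by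
    rintro ⟨x, y⟩ S
    rw [hBw]
    change singularCohomology.map ℂ ℂ
      (Motives.AlgPoints.mapContinuous (L := ℂ) (x • 𝟙 A + y • φ).hom.hom.hom) k
        (cupPowOne ℂ _ k _) = _
    rw [map_cupPowOne]
    have e : (fun i => singularCohomology.map ℂ ℂ
        (Motives.AlgPoints.mapContinuous (L := ℂ) (x • 𝟙 A + y • φ).hom.hom.hom) 1
          ((b ∘ (Set.powersetCard.ofFinEmbEquiv.symm S)) i)) =
        fun i => ((x : ℂ) + (y : ℂ) * lam (Set.powersetCard.ofFinEmbEquiv.symm S i)) •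
          (b ∘ (Set.powersetCard.ofFinEmbEquiv.symm S)) i := by
      funext i
      exact complexBetti_map_nsmul_id_add_nsmul_one_of_mem_eigenspace (hb_mem _) x y
    rw [e, MultilinearMap.map_smul_univ]
  -- the coordinates of `c` live on sign patterns matched by the test value
  have hmatch : ∀ S, Bw.repr c S ≠ 0 → cS S (x₀, y₀) = c₀ := by
    intro S hS
    have h0 := repr_apply_sub_smul_of_diagonal Bw Tp cS hact (fun _ => c₀) (x₀, y₀) c S
    have hzero : Tp (x₀, y₀) c - c₀ • c = 0 := by
      rw [sub_eq_zero]
      exact hc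
    rw [hzero, map_zero, Finsupp.zero_apply] at h0
    rcases mul_eq_zero.mp h0.symm with h1 | h1
    · exact sub_eq_zero.mp h1
    · exact absurd h1 hS
  have hchar : ∀ S, Bw.repr c S ≠ 0 → ∀ x y : ℕ, cS S (x, y) = χ x y := by
    intro S hS x y
    exact H (lam ∘ Set.powersetCard.ofFinEmbEquiv.symm S) (fun i => hlam _) (hmatch S hS) x y
  -- conclusion: expand `c` in the wedge basis
  rw [mem_pullbackEigenclasses_iff]
  intro x y
  have hc_exp : c = ∑ S ∈ (Bw.repr c).support, Bw.repr c S • Bw S := by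
    conv_lhs => rw [← Bw.linearCombination_repr c]
    rw [Finsupp.linearCombination_apply, Finsupp.sum]
  change Tp (x, y) c = χ x y • c
  conv_lhs => rw [hc_exp]
  rw [map_sum]
  have hterm : ∀ S ∈ (Bw.repr c).support,
      Tp (x, y) (Bw.repr c S • Bw S) = χ x y • (Bw.repr c S • Bw S) := by
    intro S hS
    rw [map_smul, hact, hchar S (Finsupp.mem_support_iff.mp hS) x y, smul_comm]
  rw [Finset.sum_congr rfl hterm, ← Finset.smul_sum, ← hc_exp]

end Engine

/-! ### Surfaces: the eigenspaces of `(𝟙 + ψ)^*` on `H²` are inside the Weil lines -/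

section Surface

variable {B : Motives.AbelianVariety ℂ}

/-- `(1 + μ)(1 - μ) ≠ (1 + μ)²` and `(1 - μ)(1 + μ) ≠ (1 + μ)²` and `(1 - μ)² ≠ (1 + μ)²` for
`μ = i√d`, `d ≥ 1` (`μ ≠ 0`, `μ ≠ -1` as `μ² = -d`): the three characters of `⋀²H¹` at the test
value `(1, 1)` are distinct from `(1 + μ)²` unless both signs are `+`. Stated for a sign pattern
`ε : Fin 2 → {μ, -μ}`. [folklore] -/
theorem eq_of_prod_one_add_eq_sq {d : ℕ} (hd : 0 < d) {s : ℂ}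
    (hs : s = Complex.I * (Real.sqrt d : ℂ) ∨ s = -(Complex.I * (Real.sqrt d : ℂ)))
    (ε : Fin 2 → ℂ)
    (hε : ∀ i, ε i = Complex.I * (Real.sqrt d : ℂ) ∨ ε i = -(Complex.I * (Real.sqrt d : ℂ)))
    (hprod : (∏ i, ((1 : ℂ) + 1 * ε i)) = (1 + s) ^ 2) : ∀ i, ε i = s := by
  set μ : ℂ := Complex.I * (Real.sqrt d : ℂ) with hμdef
  have hμ0 : μ ≠ 0 := I_mul_sqrt_ne_zero hd
  have hμsq : μ ^ 2 = -(d : ℂ) := I_mul_sqrt_sq d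
  -- `1 + s ≠ 0` and `1 - s ≠ 0`: else `s² = 1 = -d`
  have hd0 : (d : ℂ) ≠ -1 := by
    intro h
    have h' : ((d : ℝ) : ℂ) = ((-1 : ℝ) : ℂ) := by push_cast; exact h
    have h'' : (d : ℝ) = -1 := Complex.ofReal_injective h'
    have : (0 : ℝ) < d := by exact_mod_cast hd
    linarith
  have hs_sq : s ^ 2 = -(d : ℂ) := by
    rcases hs with rfl | rfl
    · exact hμsq
    · rw [neg_sq]; exact hμsq
  have h1s : (1 : ℂ) + s ≠ 0 := by
    intro h
    have : s = -1 := by linear_combination h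
    rw [this] at hs_sq
    exact hd0 (by linear_combination hs_sq)
  have hs0 : s ≠ 0 := by
    rcases hs with rfl | rfl
    · exact hμ0
    · exact neg_ne_zero.mpr hμ0
  -- the other sign is `-s`
  have hother : ∀ i, ε i ≠ s → ε i = -s := by
    intro i hi
    rcases hs with rfl | rfl
    · rcases hε i with h | h
      · exact absurd h hi
      · exact h
    · rcases hε i with h | h
      · rw [h, neg_neg]
      · exact absurd h hi
  rw [Fin.prod_univ_two, one_mul, one_mul] at hprod
  by_contra hnot
  push Not at hnot
  obtain ⟨i, hi⟩ := hnot
  have key : ((1 : ℂ) + ε 0) * (1 + ε 1) - (1 + s) ^ 2 = 0 := sub_eq_zero.mpr hprod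
  fin_cases i
  · have h0 : ε 0 = -s := hother 0 hi
    rcases eq_or_ne (ε 1) s with h1 | h1
    · rw [h0, h1] at key
      -- `(1 - s)(1 + s) - (1 + s)² = -2 s (1 + s)`
      have : (-2 * s) * (1 + s) = 0 := by linear_combination key
      rcases mul_eq_zero.mp this with h | h
      · exact hs0 (by linear_combination h / (-2))
      · exact h1s h
    · rw [h0, hother 1 h1] at key
      -- `(1 - s)² - (1 + s)² = -4 s`
      have : (-4 : ℂ) * s = 0 := by linear_combination key
      exact hs0 (by linear_combination this / (-4))
  · have h1 : ε 1 = -s := hother 1 hi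
    rcases eq_or_ne (ε 0) s with h0 | h0
    · rw [h0, h1] at key
      have : (-2 * s) * (1 + s) = 0 := by linear_combination key
      rcases mul_eq_zero.mp this with h | h
      · exact hs0 (by linear_combination h / (-2))
      · exact h1s h
    · rw [hother 0 h0, h1] at key
      have : (-4 : ℂ) * s = 0 := by linear_combination key
      exact hs0 (by linear_combination this / (-4))

/-- **`b₁(B(ℂ); ℂ) = 2 dim B`** for a complex abelian variety: `dim_ℂ H¹(B(ℂ); ℂ) = dim_ℚ H¹(B(ℂ); ℚ)`
(universal coefficients over a field, `finrank_singularCohomology_eq_bettiNumber_of_field`,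
`bettiNumber_eq_of_algebra`) `= 2 dim B` (`finrank_bettiCohomology_one_eq_of_natCard_torsionPoints`
with `natCard_torsionPoints_of_isAlgClosed_holds`; Mumford §1 (3) with §6 App. 3) — the same
assembly as `Motives.AbelianVariety.finrank_complexBetti_one`. [cite: MumfordAV1970, §1 (3)] -/
theorem surface_finrank_complexBetti_one (B : Motives.AbelianVariety ℂ) :
    Module.finrank ℂ (complexBetti B.X 1) = 2 * B.dim := by
  rw [← Motives.AbelianVariety.finrank_bettiCohomology_one_eq_of_natCard_torsionPoints B
    (Motives.AbelianVariety.natCard_torsionPoints_of_isAlgClosed_holds B ℂ)]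
  change Module.finrank ℂ (singularCohomology ℂ ℂ (B.Points ℂ) 1) =
    Module.finrank ℚ (singularCohomology ℚ ℚ (B.Points ℂ) 1)
  rw [finrank_singularCohomology_eq_bettiNumber_of_field,
    finrank_singularCohomology_eq_bettiNumber_of_field, bettiNumber_eq_of_algebra ℚ ℂ]

/-- **`H•(B(ℂ); ℂ) = ⋀• H¹(B(ℂ); ℂ)`** for a complex abelian variety: `B(ℂ)` is a compact connected
group `2 dim B`-manifold with `b₁ = 2 dim B`, so Hopf's theorem in the tree's form
`hasExteriorCohomologyH1_of_group` applies — the same assembly as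
`Motives.AbelianVariety.hasExteriorCohomologyH1_complexPoints`.
[cite: LangeBirkenhake1992, Lemma 1.1.17 and Exercise 1.1.6 (7)–(8)] -/
theorem surface_hasExteriorCohomologyH1 (B : Motives.AbelianVariety ℂ) :
    HasExteriorCohomologyH1 ℂ (Motives.ComplexPoints B.X) := by
  letI := (Motives.AbelianVariety.isSmoothProjective_holds (A := B)).chartedSpace
  exact hasExteriorCohomologyH1_of_group ℂ (G := B.Points ℂ) (n := 2 * B.dim)
    (surface_finrank_complexBetti_one B).ge

/-- `b₁(B) = 4 = 2·(2·1)` for an abelian surface. [cite: LangeBirkenhake1992, Lemma 1.1.17] -/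
theorem finrank_complexBetti_one_of_dim_eq_two (hB : B.dim = 2) :
    Module.finrank ℂ (complexBetti B.X 1) = 2 * (2 * 1) := by
  rw [surface_finrank_complexBetti_one, hB]

/-- The single test endomorphism `(𝟙 + ψ)^*` is the test endomorphism `(1·𝟙 + 1·ψ)^*` of
`WeilClasses`. [folklore] -/
theorem complexBetti_map_one_add_eq {ψ : B ⟶ B} (k : ℕ) (c : complexBetti B.X k) :
    complexBetti.map ((1 : ℕ) • 𝟙 B + (1 : ℕ) • ψ).hom.hom.hom k c =
      (complexBetti.map (𝟙 B + ψ).hom.hom.hom k).hom c := by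
  rw [one_smul, one_smul]

/-- **On a surface, the `(1 + i√d)²`-eigenspace of `(𝟙 + ψ)^*` on `H²(B(ℂ); ℂ)` lies in the Weil
line `E₊ = weilClassesPlus B ψ 1 d`** (`ψ ≫ ψ = -(d • 𝟙 B)`, `d ≥ 1`): in `⋀²H¹ = ⋀²V₊ ⊕ V₊∧V₋ ⊕ ⋀²V₋`
the characters of `(𝟙 + ψ)^*` are `(1 + i√d)²`, `1 + d`, `(1 - i√d)²`, pairwise distinct, so the
eigenspace is `⋀²V₊`, on which every `(x·𝟙 + y·ψ)^*` acts by `(x + y i√d)²`. This is the bridge from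
the single-test rendering of "Weil type" (route `HeckePrymWeil`; `Motives.exists_cmWeilSurface_aimedSplitProduct…`)
to `WeilClasses` for the partner surfaces of the product trick.
[cite: vanGeemen1994HodgeAV, 4.9 and proof of Thm. 6.12] -/
theorem eigenspace_le_weilClassesPlus_two (hB : B.dim = 2) {d : ℕ} (hd : 0 < d) {ψ : B ⟶ B}
    (hψ : ψ ≫ ψ = -(d • 𝟙 B)) :
    Module.End.eigenspace (complexBetti.map (𝟙 B + ψ).hom.hom.hom 2).hom
        ((1 + Complex.I * (Real.sqrt d : ℂ)) ^ 2) ≤ weilClassesPlus B ψ 1 d := by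
  intro c hc
  rw [Module.End.mem_eigenspace_iff] at hc
  have hc' : complexBetti.map ((1 : ℕ) • 𝟙 B + (1 : ℕ) • ψ).hom.hom.hom 2 c =
      ((1 + Complex.I * (Real.sqrt d : ℂ)) ^ 2) • c := by
    rw [complexBetti_map_one_add_eq]; exact hc
  have h := mem_pullbackEigenclasses_of_map_test_eq_smul (k := 2)
    (surface_hasExteriorCohomologyH1 B)
    (finrank_complexBetti_one_of_dim_eq_two hB) hd hψ 1 1 ((1 + Complex.I * (Real.sqrt d : ℂ)) ^ 2)
    (fun x y => ((x : ℂ) + (y : ℂ) * Complex.I * (Real.sqrt d : ℂ)) ^ (2 * 1)) ?_ hc'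
  · exact h
  · intro ε hε hprod x y
    have hall := eq_of_prod_one_add_eq_sq hd (Or.inl rfl) ε hε
      (by rw [← hprod]; simp only [Nat.cast_one])
    rw [Fin.prod_univ_two, hall 0, hall 1]
    ring

/-- **On a surface, the `(1 - i√d)²`-eigenspace of `(𝟙 + ψ)^*` on `H²(B(ℂ); ℂ)` lies in the Weil
line `E₋ = weilClassesMinus B ψ 1 d`.** [cite: vanGeemen1994HodgeAV, 4.9 and proof of Thm. 6.12] -/
theorem eigenspace_le_weilClassesMinus_two (hB : B.dim = 2) {d : ℕ} (hd : 0 < d) {ψ : B ⟶ B}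
    (hψ : ψ ≫ ψ = -(d • 𝟙 B)) :
    Module.End.eigenspace (complexBetti.map (𝟙 B + ψ).hom.hom.hom 2).hom
        ((1 - Complex.I * (Real.sqrt d : ℂ)) ^ 2) ≤ weilClassesMinus B ψ 1 d := by
  intro c hc
  rw [Module.End.mem_eigenspace_iff] at hc
  have hc' : complexBetti.map ((1 : ℕ) • 𝟙 B + (1 : ℕ) • ψ).hom.hom.hom 2 c =
      ((1 - Complex.I * (Real.sqrt d : ℂ)) ^ 2) • c := by
    rw [complexBetti_map_one_add_eq]; exact hc
  have h := mem_pullbackEigenclasses_of_map_test_eq_smul (k := 2)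
    (surface_hasExteriorCohomologyH1 B)
    (finrank_complexBetti_one_of_dim_eq_two hB) hd hψ 1 1 ((1 - Complex.I * (Real.sqrt d : ℂ)) ^ 2)
    (fun x y => ((x : ℂ) - (y : ℂ) * Complex.I * (Real.sqrt d : ℂ)) ^ (2 * 1)) ?_ hc'
  · exact h
  · intro ε hε hprod x y
    have hall := eq_of_prod_one_add_eq_sq hd (Or.inr rfl) ε hε
      (by rw [← sub_eq_add_neg, ← hprod]; simp only [Nat.cast_one])
    rw [Fin.prod_univ_two, hall 0, hall 1]
    ring

end Surface

end Literature.AlgebraicGeometry.HodgeTheory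

end
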